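import Summits.ValiantsHypothesis.ValiantsHypothesis.Theorems.MatrixDescartes.Negative.MatrixDescartesFalseOfTropicalMonster

/-!
# Route «KPlusLogSqLaw», crux `TropicalB` (stmt-ValiantsHypothesis-19771) — the TWO-SPLIT LAW at a tight step (chord / anti-Monge inequalities)

HONEST FRAMING.  Helper toward the registered stubs `stub_tropThin` / `stub_tropFat` of `Cruxes/TropicalB/Lines/birth.lean` (crux
`Summit.ValiantsHypothesis.ValiantsHypothesis.Theses.KPlusLogSqLaw.TropicalB`, item stmt-ValiantsHypothesis-19771, route KPlusLogSqLaw; cell `pub-symmetroid`, seat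
val-sym-trop-p1 g25, 2026-08-29; `--supports … --as helper`).  A typed NECESSARY CONDITION on tight steps of ARBITRARY designs (a kill test for constructions
with long exchange cycles); it bounds nothing by itself and bears on neither `WeakLifting`, DoorA26 / DoorA34, `MatrixDescartes` (stmt-ValiantsHypothesis-18050)
nor VP ≠ VNP.

By the tight normal form (`…TropicalBTightNormalForm`, p683233) extremal unsigned chains may be assumed TIGHT: consecutive terms `q, q'` tie TWO-TERM at an
integer slope `τ` (equal weight, every other present term strictly lighter), and then differ along ONE cycle.  Write the weight of a term as the sum of its
CELL WEIGHTS `cw_τ(p, b) = τ·d(λ_p b) − v(σ_p b, b, λ_p b)` over the columns `b`.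

* `tropWeight_eq_sum_cellWeight` — `w_τ(p) = Σ_b cw_τ(p, b)`.
* **`two_split`** — if `r, r'` are present terms, both different from `q` and from `q'`, whose cell weights agree with those of `q, q'` column by column
  off a set `X` (`cw(r,b) + cw(r',b) = cw(q,b) + cw(q',b)` for `b ∉ X`), then **`Σ_{b∈X} (cw(r,b) + cw(r',b)) < Σ_{b∈X} (cw(q,b) + cw(q',b))`**.
  (Both `r` and `r'` are strictly lighter than `q` at `τ`; add and cancel.)
CHORD READING (how constructions use it).  Let the tight step exchange along the cycle with columns `b_1, …, b_ℓ` and rows `r_i = σ(b_i)`, `q'` taking the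
cells `(r_{i+1}, b_i)`.  For `2 ≤ j ≤ ℓ − 1`, if the two CHORD incidences `(r_1, b_{j−1}, l)` and `(r_j, b_ℓ, l')` are present, the two split terms
`r = q'` on `b_1..b_{j−2}`, chord at `b_{j−1}`, `q` elsewhere and `r' = q'` on `b_j..b_{ℓ−1}`, chord at `b_ℓ`, `q` elsewhere satisfy the hypothesis with
`X = {b_{j−1}, b_ℓ}`, and the law reads `cw(r_1,b_{j−1},l) + cw(r_j,b_ℓ,l') < cw(q', b_{j−1}) + cw(q', b_ℓ)`: every present chord pair of a long tight cycle is
strictly ANTI-MONGE against the cycle at its tie slope.  So a design carrying many long tight cycles through cells whose chords are present and cheap is dead;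
absent or expensive chords are the only way out (as in the Hessenberg / path sector).  The instantiation (building `r, r'` as permutations) is left to the
census files, where permutations are explicit.
[folklore: 2-opt exchange at a tie; this cell's vocabulary]
-/

set_option linter.dupNamespace false
set_option autoImplicit false

namespace Summit.ValiantsHypothesis.ValiantsHypothesis.Theorems.KPlusLogSqLaw

open Summit.ValiantsHypothesis.ValiantsHypothesis.Theorems.MatrixDescartes.Negative
open scoped BigOperators
open Finset

namespace TwoSplit

variable {m K : ℕ} (d : Fin K → ℕ) (v ε : Fin m → Fin m → Fin K → ℤ)

/-- the weight of a term is the sum of its cell weights `τ·d(λ b) − v(σ b, b, λ b)`. [folklore] -/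
theorem tropWeight_eq_sum_cellWeight (τ : ℤ) (p : Equiv.Perm (Fin m) × (Fin m → Fin K)) :
    tropWeight d v τ p = ∑ b, (τ * (d (p.2 b) : ℤ) - v (p.1 b) b (p.2 b)) := by
  unfold tropWeight
  rw [sum_sub_distrib, mul_sum]

/-- **TWO-SPLIT LAW.**  At a two-term tie of `q, q'` at slope `τ`, two present terms `r, r' ∉ {q, q'}` whose cell weights agree with those of `q, q'`
column by column off `X` have `Σ_{b∈X} (cw(r,b) + cw(r',b)) < Σ_{b∈X} (cw(q,b) + cw(q',b))`. [folklore] -/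
theorem two_split (τ : ℤ) {q q' r r' : Equiv.Perm (Fin m) × (Fin m → Fin K)}
    (htie : tropWeight d v τ q = tropWeight d v τ q')
    (honly : ∀ s, termSign ε s ≠ 0 → s ≠ q → s ≠ q' → tropWeight d v τ s < tropWeight d v τ q)
    (hr : termSign ε r ≠ 0) (hrq : r ≠ q) (hrq' : r ≠ q')
    (hr' : termSign ε r' ≠ 0) (hr'q : r' ≠ q) (hr'q' : r' ≠ q')
    (X : Finset (Fin m))
    (hagree : ∀ b, b ∉ X →
      (τ * (d (r.2 b) : ℤ) - v (r.1 b) b (r.2 b)) + (τ * (d (r'.2 b) : ℤ) - v (r'.1 b) b (r'.2 b)) =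
      (τ * (d (q.2 b) : ℤ) - v (q.1 b) b (q.2 b)) + (τ * (d (q'.2 b) : ℤ) - v (q'.1 b) b (q'.2 b))) :
    ∑ b ∈ X, ((τ * (d (r.2 b) : ℤ) - v (r.1 b) b (r.2 b)) + (τ * (d (r'.2 b) : ℤ) - v (r'.1 b) b (r'.2 b))) <
      ∑ b ∈ X, ((τ * (d (q.2 b) : ℤ) - v (q.1 b) b (q.2 b)) + (τ * (d (q'.2 b) : ℤ) - v (q'.1 b) b (q'.2 b))) := by
  classical
  have h1 := honly r hr hrq hrq'
  have h2 := honly r' hr' hr'q hr'q'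
  rw [htie] at h2
  rw [tropWeight_eq_sum_cellWeight, tropWeight_eq_sum_cellWeight] at h1 h2
  -- `w r + w r' < w q + w q'`, as sums of the paired cell weights
  have hsum : ∑ b, ((τ * (d (r.2 b) : ℤ) - v (r.1 b) b (r.2 b)) + (τ * (d (r'.2 b) : ℤ) - v (r'.1 b) b (r'.2 b))) <
      ∑ b, ((τ * (d (q.2 b) : ℤ) - v (q.1 b) b (q.2 b)) + (τ * (d (q'.2 b) : ℤ) - v (q'.1 b) b (q'.2 b))) := by
    rw [sum_add_distrib, sum_add_distrib]; linarith
  -- split both sums at `X`; the parts off `X` agree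
  rw [← sum_add_sum_compl X, ← sum_add_sum_compl X] at hsum
  have hoff : ∑ b ∈ Xᶜ, ((τ * (d (r.2 b) : ℤ) - v (r.1 b) b (r.2 b)) + (τ * (d (r'.2 b) : ℤ) - v (r'.1 b) b (r'.2 b))) =
      ∑ b ∈ Xᶜ, ((τ * (d (q.2 b) : ℤ) - v (q.1 b) b (q.2 b)) + (τ * (d (q'.2 b) : ℤ) - v (q'.1 b) b (q'.2 b))) :=
    sum_congr rfl fun b hb => hagree b (mem_compl.mp hb)
  linarith

/-- **One-sided form**: the same with `r'` allowed to be `q'` itself (then only `r` is strictly lighter): `≤` becomes `<` through `r`. [folklore] -/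
theorem two_split_left (τ : ℤ) {q q' r : Equiv.Perm (Fin m) × (Fin m → Fin K)}
    (honly : ∀ s, termSign ε s ≠ 0 → s ≠ q → s ≠ q' → tropWeight d v τ s < tropWeight d v τ q)
    (hr : termSign ε r ≠ 0) (hrq : r ≠ q) (hrq' : r ≠ q')
    (X : Finset (Fin m))
    (hagree : ∀ b, b ∉ X → (τ * (d (r.2 b) : ℤ) - v (r.1 b) b (r.2 b)) = (τ * (d (q.2 b) : ℤ) - v (q.1 b) b (q.2 b))) :
    ∑ b ∈ X, (τ * (d (r.2 b) : ℤ) - v (r.1 b) b (r.2 b)) < ∑ b ∈ X, (τ * (d (q.2 b) : ℤ) - v (q.1 b) b (q.2 b)) := by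
  classical
  have h1 := honly r hr hrq hrq'
  rw [tropWeight_eq_sum_cellWeight, tropWeight_eq_sum_cellWeight, ← sum_add_sum_compl X, ← sum_add_sum_compl X] at h1
  have hoff : ∑ b ∈ Xᶜ, (τ * (d (r.2 b) : ℤ) - v (r.1 b) b (r.2 b)) = ∑ b ∈ Xᶜ, (τ * (d (q.2 b) : ℤ) - v (q.1 b) b (q.2 b)) :=
    sum_congr rfl fun b hb => hagree b (mem_compl.mp hb)
  linarith

end TwoSplit

end Summit.ValiantsHypothesis.ValiantsHypothesis.Theorems.KPlusLogSqLaw
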